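import Literature.MathematicalPhysics.QuantumFieldTheory.Balaban1983to89.T3PrintedRegularOrbits
import Literature.MathematicalPhysics.QuantumFieldTheory.Balaban1983to89.T3OrbitAverage
import Literature.MathematicalPhysics.QuantumFieldTheory.Balaban1983to89.B12GaugeOrbits021
import HarnessLib

/-!
# (RG-K) Print's rooted sheet `IsResidual` ⇒ residual, and the countability rows of `↥S`

Fourth (definition-free, olean-independent) file of the RG-K letters for LINE g18-1
`Cruxes/FluctuationComparisonRegPrIntL/Lines/semiclassical_s2beta.lean` (crux `stmt-QuantumFields-20520`, row LAPLACE ∕ LIMIT).  It closes the two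
group-side seams w5-20520 g13's LIMIT-INST SIGNATURE (17:57Z) names:

* GAP 4 — the (C3β″) tubular chart of px21 g9 produces gauge transformations in PRINT'S rooted sheet
  `B12GaugeOrbits021.IsResidual k w` («`w = 1` on the embedded coarse lattice `T⁽ᵏ⁾`», [Balaban1987RG1] p.256), while LIMIT's group is v7's
  `ResidualGauge F hJK` («`D_{J,K}(U^w) = D_{J,K}U` for every `U`»).  §1 proves `IsResidual (K − J) w ⇒ w residual` in the written-out form that
  IS membership in `…ResidualSubgroup.residualSubgroup F hJK` by `Iff.rfl` (`residual_of_isResidual`), through the dictionary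
  `transfUp u k y = u (embIter k y)` and `w↓ ≡ 1` (lit ✓`T3PrintedRegularOrbits.descendTo_gaugeAct`).
* the instance rows `FirstCountableTopology ∕ SecondCountableTopology ↥S` for ANY subgroup `S` of `SU(2)^{sites}` (§2; by the Π and subtype
  instances once lit `T3OrbitAverage`'s scoped `SecondCountableTopology SU(N)` is open — stated as theorems so that a consumer without the scope
  has them BY NAME).

HONEST: bookkeeping; this file proves NO stub of the line — EXW, GAP♯, LAPLACE (CHART∞ ∕ LIMIT ∕ KNIT ∕ DECAY), H4ᶜ, LFR♯ᶜ, S2β and crux 20520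
stay OPEN; rung R3 (YM₃ on T³) is NOT d = 4, NOT infinite volume, NOT a mass gap, NOT Clay; the Yang–Mills mass gap is NOT proved.
-/

noncomputable section

open MeasureTheory Filter Topology Set
open Literature.MathematicalPhysics.QuantumFieldTheory.Balaban1983to89
open Literature.MathematicalPhysics.QuantumFieldTheory.Balaban1983to89.T3ContinuumYM3Torus
open Literature.MathematicalPhysics.QuantumFieldTheory.Balaban1983to89.T3UnitLawDensityEML
open Literature.MathematicalPhysics.QuantumFieldTheory.Balaban1983to89.T3TiltDescent
open Literature.MathematicalPhysics.QuantumFieldTheory.Balaban1983to89.T3PrintedRegularOrbits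
open Literature.MathematicalPhysics.QuantumFieldTheory.Balaban1983to89.T3LevelShift
open Literature.MathematicalPhysics.QuantumFieldTheory.Balaban1983to89.T4Continuum
open Literature.MathematicalPhysics.QuantumFieldTheory.Balaban1983to89.B15DeterminingSets (embIter)
open Literature.MathematicalPhysics.QuantumFieldTheory.Balaban1983to89.B12GaugeOrbits021 (IsResidual)
open scoped Literature.MathematicalPhysics.QuantumFieldTheory.Balaban1983to89.T3OrbitAverage

namespace Summit.QuantumFields.YangMills.Theorems.FluctuationComparisonRegPrIntLS2BetaResidualGaugeRooted

/-! ## §1 `IsResidual (K − J) w` ⇒ `w` is residual (GAP 4 of the LIMIT-INST seam) -/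

section Rooted

variable (F : T3Family) {J K : ℕ} (hJK : J ≤ K)

/-- The two spellings of «restriction up the block centres» agree: `u^{(k)}(y) = u(emb^{k} y)` (`T4Continuum.transfUp` vs the centre
embedding `B15DeterminingSets.embIter` of `B16Sect1Backgrounds.toMS`). [cite: Balaban1985Averaging, (12) p.19; Balaban1987RG1, (0.1) p.251] -/
theorem transfUp_eq_apply_embIter {P : Params} {G : Type*} (u : GaugeTransf P 0 G) :
    ∀ (k : ℕ) (y : Site P k), transfUp u k y = u (embIter k y)
  | 0, _ => rfl
  | k + 1, y => transfUp_eq_apply_embIter u k (emb y)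

/-- The restricted transformation `w↓` read through the centre embedding. [cite: Balaban1985Averaging, (12)-(13) p.19] -/
theorem descTransf_apply (w : Site (F.P K) 0 → Matrix.specialUnitaryGroup (Fin 2) ℂ) (x : Site (F.P J) 0) :
    descTransf F J K hJK w x = w (embIter (K - J) (siteShift (sites_eq F J K hJK) x)) :=
  transfUp_eq_apply_embIter w (K - J) _

/-- Print's rooted sheet restricts to the trivial transformation: `IsResidual (K − J) w ⇒ w↓ ≡ 1`.
[cite: Balaban1987RG1, p.256 (three sentences after (0.21))] -/
theorem descTransf_eq_one_of_isResidual {w : Site (F.P K) 0 → Matrix.specialUnitaryGroup (Fin 2) ℂ}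
    (hw : IsResidual (K - J) w) : descTransf F J K hJK w = fun _ => 1 := by
  funext x
  rw [descTransf_apply]
  exact hw _

/-- ★ **GAP 4: PRINT'S ROOTED SHEET IS RESIDUAL** — `IsResidual (K − J) w` («`w = 1` on `T⁽ᴷ⁻ᴶ⁾`») implies `D_{J,K}(U^w) = D_{J,K}U` for every
fine `U`, i.e. `w ∈ residualSubgroup F hJK` of `…ResidualSubgroup` by `Iff.rfl` (and `w` in the v7 set `ResidualGauge F hJK` by `rfl`).  The
converse fails exactly by the central sheets `w↓ ≡ −1`. [cite: Balaban1987RG1, p.256 (three sentences after (0.21)); Balaban1985Variational, (4) p.278] -/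
theorem residual_of_isResidual {w : Site (F.P K) 0 → Matrix.specialUnitaryGroup (Fin 2) ℂ} (hw : IsResidual (K - J) w) :
    ∀ U : GaugeField (F.P K) 0 (Matrix.specialUnitaryGroup (Fin 2) ℂ),
      descendTo F ℰp J K hJK (GaugeField.gaugeAct w U) = descendTo F ℰp J K hJK U := by
  intro U
  rw [descendTo_gaugeAct, descTransf_eq_one_of_isResidual F hJK hw]
  exact B12RTGaugeInvariance254.gaugeAct_one' _

/-- The same, for a transformation paired with pivot data (the shape `(e z).1` of the (C3β″) chart): membership of the first component in
the v7 residual set. [cite: Balaban1987RG1, p.256 (three sentences after (0.21))] -/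
theorem fst_mem_residualGauge_of_isResidual {C : Type*}
    {k : (Site (F.P K) 0 → Matrix.specialUnitaryGroup (Fin 2) ℂ) × (C → Matrix.specialUnitaryGroup (Fin 2) ℂ)}
    (hw : IsResidual (K - J) k.1) :
    k.1 ∈ {w : Site (F.P K) 0 → Matrix.specialUnitaryGroup (Fin 2) ℂ |
      ∀ U : GaugeField (F.P K) 0 (Matrix.specialUnitaryGroup (Fin 2) ℂ),
        descendTo F ℰp J K hJK (GaugeField.gaugeAct w U) = descendTo F ℰp J K hJK U} :=
  residual_of_isResidual F hJK hw

end Rooted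

/-! ## §2 Countability rows of `↥S` for a subgroup `S` of `SU(2)^{sites}` -/

section Countability

variable {P : Params} {j : ℕ}

/-- `↥S` is second countable for every subgroup `S` of `SU(2)^{sites}` (Π of second-countable factors over a finite index, then subtype).
[cite: BrockerTomDieck1985, I (1.10)] -/
theorem secondCountableTopology_subgroup (S : Subgroup (Site P j → Matrix.specialUnitaryGroup (Fin 2) ℂ)) :
    SecondCountableTopology S :=
  TopologicalSpace.Subtype.secondCountableTopology _

/-- `↥S` is first countable for every subgroup `S` of `SU(2)^{sites}`. [cite: BrockerTomDieck1985, I (1.10)] -/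
theorem firstCountableTopology_subgroup (S : Subgroup (Site P j → Matrix.specialUnitaryGroup (Fin 2) ℂ)) :
    FirstCountableTopology S := by
  haveI := secondCountableTopology_subgroup S
  infer_instance

/-- `↥(S × SU(2)^{C})`-type carriers of the enlarged group: the product of `↥S` with a finite power of `SU(2)` is second countable.
[cite: BrockerTomDieck1985, I (1.10)] -/
theorem secondCountableTopology_subgroup_prod {C : Type*} [Finite C] (S : Subgroup (Site P j → Matrix.specialUnitaryGroup (Fin 2) ℂ)) :
    SecondCountableTopology (S × (C → Matrix.specialUnitaryGroup (Fin 2) ℂ)) := by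
  haveI := secondCountableTopology_subgroup S
  haveI : Countable C := Finite.to_countable
  infer_instance

/-- … and first countable. [cite: BrockerTomDieck1985, I (1.10)] -/
theorem firstCountableTopology_subgroup_prod {C : Type*} [Finite C] (S : Subgroup (Site P j → Matrix.specialUnitaryGroup (Fin 2) ℂ)) :
    FirstCountableTopology (S × (C → Matrix.specialUnitaryGroup (Fin 2) ℂ)) := by
  haveI := secondCountableTopology_subgroup_prod (C := C) S
  infer_instance

end Countability

end Summit.QuantumFields.YangMills.Theorems.FluctuationComparisonRegPrIntLS2BetaResidualGaugeRooted

end
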